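import Literature.Combinatorics.Sahi2008.Symmetry
import Literature.Combinatorics.Sahi2008.Multilinear
import Literature.Combinatorics.Sahi2008.FKG
import Mathlib.GroupTheory.Perm.Fin
import Mathlib.Tactic.Linarith
import Mathlib.Tactic.Ring
import HarnessLib

/-!
# `NoHeavyLowerTail` (stmt-CriticalPhenomena-4575) — Sahi's `C_n` for ALL `n` on MEET TOWERS

Support file, seat `prim-l12-p5` (gen 3), `--supports stmt-CriticalPhenomena-4575`.  No definitions, no named facts, no sorries.

**Hierarchy identity** (`sahiE_cons_eq_of_pairwise`, any weight `μ`, any functions).  If the head slot `d` absorbs every pairwise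
product of the other slots, `f_i·f_j·d = f_i·f_j` for `i ≠ j` (for indicators: `D ⊇ A_i ∩ A_j`), then

  `E_{n+3}(d, f_0,…,f_{n+1}) = (n+2 − E d)·E_{n+2}(f) + Σ_i E[f_i(1 − d)]·E_{n+1}(f without slot i)`.

Proof: the Lieb–Sahi recursion in the head slot (`sahiE_fin_cons`), multilinearity (`f_i d = f_i − f_i(1−d)`), and the evaluation
`E_{m+2}(r, g) = −E_{m+1}(g)·E(r)` when `r` annihilates every slot of `g` (`sahiE_cons_of_mul_eq_zero`; the recursion once more, all
product slots vanish), transported to an arbitrary slot by permutation invariance (`sahiE_update_eq_sahiE_cons`, via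
`Fin.insertNth_comp_cycleRange_symm` and the tree's `sahiE_comp_perm`).

**Consequences.**  `sahiE_cons_nonneg_of_pairwise` (the RUNG): for a probability weight, nonnegative `f_i` and `d ≤ 1` absorbing the
pairwise products, `E_{n+3}(d,f) ≥ 0` as soon as `E_{n+2}(f) ≥ 0` and `E_{n+1}` of every sub-family `f ∖ f_i` is `≥ 0` — Sahi's `C_{n+3}` on this
shape follows from `C_{n+2}`, `C_{n+1}` of the sub-families, with NO correlation inequality beyond those.  Hence, by induction from `E₁ = E ≥ 0`
and `E₂ = Cov ≥ 0` (FKG):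

* **`sahiE_nonneg_of_meetTower`** — for every FKG probability weight on a finite distributive lattice, every `m`, and every family of
  monotone `{0,1}`-valued functions `f_0,…,f_{m−1}` forming a MEET TOWER read from the head (`f_j·f_k·f_i = f_j·f_k` whenever `i < j`, `i < k`,
  `j ≠ k`: each slot contains the pairwise meets of all later slots — e.g. any chain, or `(D, C, A, B)` with `C ⊇ A∩B`,
  `D ⊇ (A∩B)∪(A∩C)∪(B∩C)`), **`E_m(f) ≥ 0`**: Sahi's conjecture `C_m` holds on meet towers for ALL `m` (any slot order, by `sahiE_comp_perm`).
  The case `m = 3` is the meet-containment theorem of `…SahiE3MeetContainment`; `m = 4` is `…SahiE4MeetTower`.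
Identity verified exactly for `n ≤ 6` on random events and weights before formalisation (seat `code/en_meet.py`, 400 instances, 0 failures).
-/

namespace Summit.CriticalPhenomena.PercolationContinuityZ3.Theorems

namespace SahiMeetTowerAll

open Finset Function Literature.Combinatorics.Sahi2008

variable {α : Type*} [Fintype α]

/-- **Annihilated head slot**: if `g_j · r = 0` for every slot then `E_{n+2}(r, g) = −E_{n+1}(g)·E(r)`. [this file] -/
theorem sahiE_cons_of_mul_eq_zero (μ : α → ℝ) (n : ℕ) (r : α → ℝ) (g : Fin (n + 1) → α → ℝ)
    (h : ∀ j, g j * r = 0) :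
    sahiE μ (n + 2) (Fin.cons r g : Fin (n + 2) → α → ℝ) = -(sahiE μ (n + 1) g * ex μ r) := by
  rw [sahiE_fin_cons]
  have hz : ∀ j, sahiE μ (n + 1) (update g j (g j * r)) = 0 := fun j => by
    rw [h j]; exact sahiE_update_zero μ g j
  simp only [hz, Finset.sum_const_zero]
  ring

/-- **Moving a slot to the head**: `E_{n+1}(f with slot i replaced by r) = E_{n+1}(r, f without slot i)`. [this file] -/
theorem sahiE_update_eq_sahiE_cons (μ : α → ℝ) (n : ℕ) (f : Fin (n + 1) → α → ℝ) (i : Fin (n + 1)) (r : α → ℝ) :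
    sahiE μ (n + 1) (update f i r) = sahiE μ (n + 1) (Fin.cons r (i.removeNth f) : Fin (n + 1) → α → ℝ) := by
  have e : update f i r = i.insertNth r (i.removeNth f) := by
    symm
    rw [Fin.insertNth_eq_iff]
    refine ⟨by simp, ?_⟩
    funext j
    simp only [Fin.removeNth, update_of_ne (Fin.succAbove_ne i j)]
  rw [e]
  have key : sahiE μ (n + 1) (i.insertNth r (i.removeNth f) ∘ i.cycleRange.symm)
      = sahiE μ (n + 1) (i.insertNth r (i.removeNth f)) :=
    sahiE_comp_perm μ (n + 1) (i.cycleRange.symm) _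
  rw [Fin.insertNth_comp_cycleRange_symm] at key
  exact key.symm

/-- **Hierarchy identity.**  If `f_i·f_j·d = f_i·f_j` for all `i ≠ j`, then
`E_{n+3}(d, f) = (n + 2 − E d)·E_{n+2}(f) + Σ_i E(f_i − f_i d)·E_{n+1}(f without slot i)` (any weight). [this file] -/
theorem sahiE_cons_eq_of_pairwise (μ : α → ℝ) (n : ℕ) (d : α → ℝ) (f : Fin (n + 2) → α → ℝ)
    (hpair : ∀ i j, i ≠ j → f i * f j * d = f i * f j) :
    sahiE μ (n + 3) (Fin.cons d f : Fin (n + 3) → α → ℝ)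
      = ((n : ℝ) + 2 - ex μ d) * sahiE μ (n + 2) f
        + ∑ i, ex μ (f i - f i * d) * sahiE μ (n + 1) (i.removeNth f) := by
  rw [sahiE_fin_cons]
  have hterm : ∀ i, sahiE μ (n + 2) (update f i (f i * d))
      = sahiE μ (n + 2) f + sahiE μ (n + 1) (i.removeNth f) * ex μ (f i - f i * d) := by
    intro i
    set r : α → ℝ := f i - f i * d with hr
    have hzero : ∀ j, i.removeNth f j * r = 0 := by
      intro j
      have hij := hpair (i.succAbove j) i (Fin.succAbove_ne i j)
      funext x
      have hx := congrArg (fun F => F x) hij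
      simp only [Pi.mul_apply, Pi.sub_apply, Pi.zero_apply, Fin.removeNth, hr] at hx ⊢
      linear_combination (-1 : ℝ) * hx
    have hsplit : f i * d = f i + (-1 : ℝ) • r := by
      funext x
      simp only [hr, Pi.mul_apply, Pi.add_apply, Pi.smul_apply, Pi.sub_apply, smul_eq_mul]
      ring
    rw [hsplit, sahiE_update_add, sahiE_update_smul, update_eq_self, sahiE_update_eq_sahiE_cons,
      sahiE_cons_of_mul_eq_zero μ n r (i.removeNth f) hzero]
    ring
  simp only [hterm]
  rw [Finset.sum_add_distrib, Finset.sum_const, Finset.card_univ, Fintype.card_fin, nsmul_eq_mul]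
  have e2 : sahiE μ (n + 1 + 1) f = sahiE μ (n + 2) f := rfl
  have e3 : (∑ i : Fin (n + 2), sahiE μ (n + 1) (i.removeNth f) * ex μ (f i - f i * d))
      = ∑ i : Fin (n + 2), ex μ (f i - f i * d) * sahiE μ (n + 1) (i.removeNth f) :=
    Finset.sum_congr rfl fun i _ => by ring
  rw [e2, e3]
  push_cast
  ring

/-- **The rung.**  Probability weight, nonnegative slots, `d ≤ 1` absorbing the pairwise products: if `E_{n+2}(f) ≥ 0` and `E_{n+1} ≥ 0` for
every sub-family of `f` with one slot removed, then `E_{n+3}(d, f) ≥ 0`. [this file] -/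
theorem sahiE_cons_nonneg_of_pairwise (μ : α → ℝ) (hμ0 : ∀ x, 0 ≤ μ x) (hμ1 : ∑ x, μ x = 1) (n : ℕ) (d : α → ℝ)
    (f : Fin (n + 2) → α → ℝ) (hf0 : ∀ i x, 0 ≤ f i x) (hd1 : ∀ x, d x ≤ 1)
    (hpair : ∀ i j, i ≠ j → f i * f j * d = f i * f j)
    (hE : 0 ≤ sahiE μ (n + 2) f) (hEi : ∀ i : Fin (n + 2), 0 ≤ sahiE μ (n + 1) (i.removeNth f)) :
    0 ≤ sahiE μ (n + 3) (Fin.cons d f : Fin (n + 3) → α → ℝ) := by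
  rw [sahiE_cons_eq_of_pairwise μ n d f hpair]
  have hd : ex μ d ≤ 1 := by
    have := ex_mono (μ := μ) hμ0 hd1
    rwa [ex_const hμ1] at this
  have hcoef : 0 ≤ (n : ℝ) + 2 - ex μ d := by
    have : (0 : ℝ) ≤ n := Nat.cast_nonneg n
    linarith
  have hri : ∀ i, 0 ≤ ex μ (f i - f i * d) := fun i =>
    ex_nonneg hμ0 fun x => by
      simp only [Pi.sub_apply, Pi.mul_apply]
      nlinarith [hf0 i x, hd1 x]
  exact add_nonneg (mul_nonneg hcoef hE) (Finset.sum_nonneg fun i _ => mul_nonneg (hri i) (hEi i))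

variable [DistribLattice α]

/-- **Sahi's `C_m` on meet towers, all `m`.**  For an FKG probability weight on a finite distributive lattice and monotone
`{0,1}`-valued `f_0,…,f_{m−1}` such that every slot absorbs the pairwise products of all LATER slots
(`f_j·f_k·f_i = f_j·f_k` for `i < j`, `i < k`, `j ≠ k`): `E_m(f) ≥ 0`. [this file] -/
theorem sahiE_nonneg_of_meetTower {μ : α → ℝ} (hμ : IsFKGMeasure μ) :
    ∀ (m : ℕ) (f : Fin m → α → ℝ), (∀ i x, f i x = 0 ∨ f i x = 1) → (∀ i, Monotone (f i)) →
      (∀ i j k : Fin m, i < j → i < k → j ≠ k → f j * f k * f i = f j * f k) → 0 ≤ sahiE μ m f := by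
  intro m
  induction m using Nat.strong_induction_on with
  | _ m ih =>
    intro f h01 hmono htower
    have hf0 : ∀ i x, 0 ≤ f i x := fun i x => by rcases h01 i x with e | e <;> simp [e]
    have hf1 : ∀ i x, f i x ≤ 1 := fun i x => by rcases h01 i x with e | e <;> simp [e]
    rcases Nat.lt_or_ge m 3 with hm | hm
    · interval_cases m
      · rw [sahiE_zero]
      · rw [sahiE_one_apply]
        exact ex_nonneg hμ.nonneg (hf0 0)
      · rw [sahiE_two_apply, sub_nonneg]
        exact ex_mul_ex_le_ex_mul hμ (hf0 0) (hf0 1) (hmono 0) (hmono 1)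
    · obtain ⟨n, rfl⟩ := Nat.exists_eq_add_of_le' hm
      -- f = cons (f 0) (tail f); the head absorbs the pairwise products of the tail
      have hsplit : (Fin.cons (f 0) (Fin.tail f) : Fin (n + 3) → α → ℝ) = f := Fin.cons_self_tail f
      rw [← hsplit]
      refine sahiE_cons_nonneg_of_pairwise μ hμ.nonneg hμ.sum_eq_one n (f 0) (Fin.tail f)
        (fun i x => hf0 _ x) (hf1 0) ?_ ?_ ?_
      · intro i j hij
        exact htower 0 i.succ j.succ (Fin.succ_pos i) (Fin.succ_pos j) (fun h => hij (Fin.succ_injective _ h))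
      · -- the tail is a tower
        refine ih (n + 2) (by omega) (Fin.tail f) (fun i x => h01 _ x) (fun i => hmono _) ?_
        intro i j k hij hik hjk
        exact htower i.succ j.succ k.succ (Fin.succ_lt_succ_iff.mpr hij) (Fin.succ_lt_succ_iff.mpr hik)
          (fun h => hjk (Fin.succ_injective _ h))
      · -- every sub-family of the tail is a tower
        intro p
        refine ih (n + 1) (by omega) (p.removeNth (Fin.tail f)) (fun i x => h01 _ x) (fun i => hmono _) ?_
        intro i j k hij hik hjk
        simp only [Fin.removeNth, Fin.tail]
        exact htower (p.succAbove i).succ (p.succAbove j).succ (p.succAbove k).succ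
          (Fin.succ_lt_succ_iff.mpr ((Fin.succAbove_lt_succAbove_iff).mpr hij))
          (Fin.succ_lt_succ_iff.mpr ((Fin.succAbove_lt_succAbove_iff).mpr hik))
          (fun h => hjk (Fin.succAbove_right_injective (Fin.succ_injective _ h)))

/-! ### Appendix (same day): any slot order, and Δ-systems (sunflowers) of increasing events -/

/-- **Meet towers in any order.**  If some reindexing `σ` of the family is a meet tower (read from the head), then `E_m(f) ≥ 0`. [this file] -/
theorem sahiE_nonneg_of_meetTower_perm {μ : α → ℝ} (hμ : IsFKGMeasure μ) (m : ℕ) (f : Fin m → α → ℝ)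
    (h01 : ∀ i x, f i x = 0 ∨ f i x = 1) (hmono : ∀ i, Monotone (f i)) (σ : Equiv.Perm (Fin m))
    (htower : ∀ i j k : Fin m, i < j → i < k → j ≠ k → f (σ j) * f (σ k) * f (σ i) = f (σ j) * f (σ k)) :
    0 ≤ sahiE μ m f := by
  rw [← sahiE_comp_perm μ m σ f]
  exact sahiE_nonneg_of_meetTower hμ m (fun i => f (σ i)) (fun i x => h01 _ x) (fun i => hmono _) htower

/-- **Sahi's `C_m` for Δ-systems (sunflowers) of increasing events, all `m`.**  FKG probability weight; monotone `{0,1}`-valued `f_0,…,f_{m−1}`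
whose pairwise products all lie below every member (`f_j·f_k ≤ f_i` for `j ≠ k` and all `i`; e.g. all pairwise intersections equal to a common
core): `E_m(f) ≥ 0`. [this file] -/
theorem sahiE_nonneg_of_pairwise_mul_le_all {μ : α → ℝ} (hμ : IsFKGMeasure μ) (m : ℕ) (f : Fin m → α → ℝ)
    (h01 : ∀ i x, f i x = 0 ∨ f i x = 1) (hmono : ∀ i, Monotone (f i))
    (hcore : ∀ i j k : Fin m, j ≠ k → ∀ x, f j x * f k x ≤ f i x) : 0 ≤ sahiE μ m f := by
  refine sahiE_nonneg_of_meetTower hμ m f h01 hmono ?_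
  intro i j k _ _ hjk
  funext x
  simp only [Pi.mul_apply]
  have h := hcore i j k hjk x
  rcases h01 i x with ei | ei <;> rcases h01 j x with ej | ej <;> rcases h01 k x with ek | ek <;>
    simp only [ei, ej, ek] at h ⊢ <;> linarith


end SahiMeetTowerAll

end Summit.CriticalPhenomena.PercolationContinuityZ3.Theorems
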